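import Literature.NumberTheory.LFunctions.TwistedPrimeSumWindow
import Literature.NumberTheory.LFunctions.DeuringHeilbronnTwoModuli
import Literature.NumberTheory.LFunctions.Zhang2022.Section5ExceptionalZero
import HarnessLib

/-!
# Zhang (2022) §5, Lemma 5.6: under (A), `∑_{p ∼ P} θ(p) p^{1+it} ≪ 𝔓 exp(−𝓛^{9/2})` for
# primitive `θ ≠ χ` mod `r`, `1 < r < T`, `|t| ≤ D`

Trunk T-ANT (NumberTheory/LFunctions). Y. Zhang, *Discrete mean estimates and the Landau–Siegel
zero*, arXiv:2211.02515v1 (2022) [Zhang2022LandauSiegel], §2 and §5 [pp. 4, 11, 12 of the source]: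

> (2.1) `𝓛 = log D`. … Assumption (A) `L(1, χ) < 𝓛⁻²⁰²²`. … (2.6) `P = exp{𝓛⁹}`. For notational
> simplicity we write `p ∼ P` for `P < p < P(1 + 𝓛⁻⁶⁸)`. … (2.9) `𝔓 := ∑_{p∼P} p = (1+o(1))P²𝓛⁻⁷⁷`.
> … [§6] `T = exp{𝓛^{1.1}}`. …
> The next two lemmas are weaker forms of the Deuring-Heillbronn [sic] Phenomenon. …
> **Lemma 5.6.** For any primitive character `θ (mod r)` with `r < T` and `θ ≠ χ`,
> `∑_{p∼P} θ(p) p^{1+it} ≪ 𝔓 exp{−𝓛^{9/2}}`  if `|t| ≤ D`.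

The manuscript states Lemma 5.6 WITHOUT PROOF OR CITATION. **Status of the source: an unrefereed
manuscript, a claimed result under adjudication** (in-tree audit of v1:
`Literature.NumberTheory.LFunctions.Zhang2022.not_ineq824`; Lemma 5.6 is upstream of the located gap,
used at (7.14)–(7.15) with `1 < r < D` and at (14.8) with `1 < r < D³`). This file PROVES the lemma
from the published record, by the classical route of Linnik's theorem:

* the truncated explicit formula for `ψ(x, θ)` (Montgomery–Vaughan Thm 12.10, PROVED in the tree:
  `truncatedExplicitFormula_psiChar_holds`), Abel-summed against `n^{-it}` and differenced over the
  window `P < n ≤ X ≤ P(1 + 𝓛⁻⁶⁸)` (`TwistedPrimeSumWindow.norm_windowSum_vonMangoldt_le`), with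
  truncation height `T₁ = exp(3𝓛^{9/2})`: each zero `ρ = β + iγ`, `|γ| ≤ T₁`, of `L(s, θ)`
  contributes `≤ (X − P) P^{β−1}`, the remainder is `≪ P𝓛¹⁸ D e^{−(3/2)𝓛^{9/2}}`;
* the exceptional zero `β₁` of `L(s, χ)` under (A) (`lemma55_exceptionalZero`: `1 − β₁ ≪ 𝓛⁻²⁰²²`)
  is not a zero of `L(s, θ)` for `θ ≠ χ` (Landau / MV Thm 11.3,
  `DeuringHeilbronnTwoModuli.exists_LFunction_exceptionalPoint_ne_zero`), and REPELS the zeros of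
  `L(s, θ)`: by the Deuring–Heilbronn phenomenon (tree: rh.S33 `deuring_heilbronn`, DISCHARGED as
  `deuring_heilbronn_holds` = Bombieri's Théorème 14; two-moduli form
  `DeuringHeilbronnTwoModuli.deuring_heilbronn_twoModuli`) every such zero with `|γ| ≤ T₁` has
  `1 − β ≥ c₂ log(c₁/((1 − β₁)Λ))/Λ ≥ 5𝓛^{−9/2}` for `D ≥ D₀`, where `Λ = 6𝓛^{9/2} ≥ log(DrT₁e)`
  (the logarithm `log(𝓛²⁰²²)` of the repulsion is what beats the `exp(O(𝓛^{9/2}))` zeros: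
  `N(T₁, θ) ≪ T₁ log T₁`, MV Thm 10.17, `exists_boxCount_le`);
* prime powers (`ψ − ϑ ≤ 2√x log x`) and discrete Abel summation with the weight `p/log p`
  (`TwistedPrimeSumWindow.norm_sum_Ioc_mul_le_of_monotone`, `div_log_le_succ`).

Main results (`𝓛 = log D`, `P = exp 𝓛⁹`):

* `lemma56_twist` — for `D ≥ D₀`, `χ ≠ χ₀` mod `D` with (A), `1 < r`, `r < exp(𝓛^{11/10})`,
  `θ` primitive mod `r` different from `χ` (as characters mod `Dr`), `|t| ≤ D` and
  `P ≤ u ≤ P(1 + 𝓛⁻⁶⁸)`: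
  `‖∑_{P < p ≤ u} θ(p) p^{-it} p‖ ≤ C P² 𝓛⁻⁷⁷ exp(−𝓛^{9/2})`;
* `lemma56` — the same with the printed twist `p^{1+it}` (**Lemma 5.6**; the printed majorant
  `𝔓 exp(−𝓛^{9/2})` is `≍ P²𝓛⁻⁷⁷exp(−𝓛^{9/2})` by (2.9); the bound is proved uniformly for every
  upper endpoint `u` of the window, which contains the printed sum `P < p < P(1 + 𝓛⁻⁶⁸)`).

Readings (stated, not hidden): (A) is `‖L(1, χ)‖ < (log D)⁻²⁰²²` and "`D` large" is
`∃ D₀ ∀ D ≥ D₀`, as in `Section5ExceptionalZero.lean`; of "`χ` real primitive" only `χ ≠ χ₀` is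
used; "`θ ≠ χ`" for characters of different moduli is rendered as inequality of their lifts to the
modulus `Dr` (for primitive `θ`, `χ` this is literally `θ ≠ χ`); `r < T = exp(𝓛^{1.1})` is
`(r : ℝ) < exp((log D)^{11/10})`. **The hypothesis `1 < r` is NOT printed** ("`r < T`" admits
`r = 1`, `θ ≡ 1`, for which the sum is `∼ 𝔓` at `t = 0` and the bound fails); every use in the
source has `r > 1`. No statement about Theorems 1–2 of the source is made or implied.
-/

noncomputable section

open Complex Filter Topology Set
open scoped Real ArithmeticFunction.vonMangoldt

namespace Literature.NumberTheory.LFunctions.Zhang2022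

open DirichletCharacter ExplicitPsiChar TwistedPrimeSumWindow DeuringHeilbronnTwoModuli

/-! ### Small real-variable facts -/

/-- For every real `M` there is `D₀` with `log D ≥ M` for all `D ≥ D₀`. [folklore] -/
private theorem exists_nat_le_log' (M : ℝ) : ∃ D₀ : ℕ, ∀ D : ℕ, D₀ ≤ D → M ≤ Real.log D := by
  refine ⟨⌈Real.exp M⌉₊ + 1, fun D hD => ?_⟩
  have h1 : Real.exp M ≤ D := by
    have : (⌈Real.exp M⌉₊ : ℝ) + 1 ≤ D := by exact_mod_cast hD
    linarith [Nat.le_ceil (Real.exp M)]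
  have hD0 : (0 : ℝ) < D := lt_of_lt_of_le (Real.exp_pos M) h1
  rw [Real.le_log_iff_exp_le hD0]
  exact h1

/-- Monotonicity of the Deuring–Heilbronn majorant in the logarithm: for `0 < ℓ ≤ Λ`, `δ > 0`,
`δΛ ≤ c₁`, `c₂ ≥ 0`: `c₂ log(c₁/(δΛ))/Λ ≤ c₂ log(c₁/(δℓ))/ℓ`. [folklore] -/
theorem dh_bound_mono {c₁ c₂ δ ℓ La : ℝ} (hc₂ : 0 ≤ c₂) (hδ : 0 < δ) (hℓ : 0 < ℓ) (hℓLa : ℓ ≤ La)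
    (hLa : δ * La ≤ c₁) :
    c₂ * Real.log (c₁ / (δ * La)) / La ≤ c₂ * Real.log (c₁ / (δ * ℓ)) / ℓ := by
  have hLa0 : 0 < La := hℓ.trans_le hℓLa
  have hδLa : 0 < δ * La := mul_pos hδ hLa0
  have hδℓ : 0 < δ * ℓ := mul_pos hδ hℓ
  have hc₁ : 0 < c₁ := hδLa.trans_le hLa
  have ha0 : 0 ≤ Real.log (c₁ / (δ * La)) := Real.log_nonneg ((one_le_div hδLa).2 hLa)
  have hab : Real.log (c₁ / (δ * La)) ≤ Real.log (c₁ / (δ * ℓ)) :=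
    Real.log_le_log (div_pos hc₁ hδLa)
      (div_le_div_of_nonneg_left hc₁.le hδℓ (mul_le_mul_of_nonneg_left hℓLa hδ.le))
  calc c₂ * Real.log (c₁ / (δ * La)) / La ≤ c₂ * Real.log (c₁ / (δ * La)) / ℓ :=
        div_le_div_of_nonneg_left (mul_nonneg hc₂ ha0) hℓ hℓLa
    _ ≤ c₂ * Real.log (c₁ / (δ * ℓ)) / ℓ :=
        div_le_div_of_nonneg_right (mul_le_mul_of_nonneg_left hab hc₂) hℓ.le

/-- Powers of `L ≥ 1`: with `M = L^{9/2}`, `1 ≤ M`, `L ≤ M`, `L^{11/10} ≤ M`, `L⁴ ≤ M`, `M ≤ L⁹`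
and `M · M = L⁹`. [folklore] -/
theorem rpow_nine_halves_facts {L : ℝ} (hL : 1 ≤ L) :
    1 ≤ L ^ ((9 : ℝ) / 2) ∧ L ≤ L ^ ((9 : ℝ) / 2) ∧ L ^ ((11 : ℝ) / 10) ≤ L ^ ((9 : ℝ) / 2) ∧
      L ^ 4 ≤ L ^ ((9 : ℝ) / 2) ∧ L ^ ((9 : ℝ) / 2) ≤ L ^ 9 ∧
      L ^ ((9 : ℝ) / 2) * L ^ ((9 : ℝ) / 2) = L ^ 9 := by
  have hL0 : 0 < L := by linarith
  refine ⟨Real.one_le_rpow hL (by norm_num), ?_, ?_, ?_, ?_, ?_⟩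
  · conv_lhs => rw [← Real.rpow_one L]
    exact Real.rpow_le_rpow_of_exponent_le hL (by norm_num)
  · exact Real.rpow_le_rpow_of_exponent_le hL (by norm_num)
  · rw [← Real.rpow_natCast L 4]
    exact Real.rpow_le_rpow_of_exponent_le hL (by norm_num)
  · rw [← Real.rpow_natCast L 9]
    exact Real.rpow_le_rpow_of_exponent_le hL (by norm_num)
  · rw [← Real.rpow_add hL0, ← Real.rpow_natCast L 9]
    norm_num

/-- `L^k ≤ exp(kM)` whenever `L ≤ M` and `0 ≤ L` (`L ≤ exp L`). [folklore] -/
theorem pow_le_exp_mul {L M : ℝ} (hL : 0 ≤ L) (hLM : L ≤ M) (k : ℕ) :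
    L ^ k ≤ Real.exp (k * M) := by
  have h1 : L ≤ Real.exp M := by
    have := Real.add_one_le_exp L
    have := Real.exp_le_exp.2 hLM
    linarith
  rw [Real.exp_nat_mul]
  exact pow_le_pow_left₀ hL h1 k

/-- The remainder terms of `TwistedPrimeSumWindow.norm_windowSum_vonMangoldt_le` with Zhang's
parameters: for `L ≥ 1`, `M = L^{9/2}`, `P = exp L⁹`, `T₁ = exp 3M`, `2 ≤ r`, `log r ≤ M`,
`|t| ≤ exp L` and `P ≤ Y ≤ 2P`,
`R(Y) ≤ (4K+6) L⁹ + 227 K P L¹⁸ e^{L} e^{−3M/2}`. [folklore] -/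
theorem remainder_le {K L r t Y : ℝ} (hK0 : 0 ≤ K) (hL1 : 1 ≤ L) (hr2 : 2 ≤ r)
    (hlogr : Real.log r ≤ L ^ ((9 : ℝ) / 2)) (ht' : |t| ≤ Real.exp L)
    (hPY : Real.exp (L ^ 9) ≤ Y) (hY2 : Y ≤ 2 * Real.exp (L ^ 9)) :
    (2 * K + 3) * Real.log Y +
        2 * K * (Y / Real.exp (3 * L ^ ((9 : ℝ) / 2))) *
          Real.log (r * Y * Real.exp (3 * L ^ ((9 : ℝ) / 2))) ^ 2 +
      |t| * K * (4 * Y * Real.log Y / Real.sqrt (9 / 4 * Real.exp (3 * L ^ ((9 : ℝ) / 2))) +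
        Y * Real.log (r * Y * Real.exp (3 * L ^ ((9 : ℝ) / 2))) ^ 2 /
          Real.exp (3 * L ^ ((9 : ℝ) / 2))) ≤
      (4 * K + 6) * L ^ 9 + 227 * K * Real.exp (L ^ 9) * L ^ 18 * Real.exp L *
        Real.exp (-(3 / 2 * L ^ ((9 : ℝ) / 2))) := by
  have hL0 : 0 < L := by linarith
  obtain ⟨hM1, hLM, hL11M, hL4M, hML9, hMM⟩ := rpow_nine_halves_facts hL1
  set M : ℝ := L ^ ((9 : ℝ) / 2) with hMdef
  set P : ℝ := Real.exp (L ^ 9) with hPdef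
  set T : ℝ := Real.exp (3 * M) with hTdef
  have hM0 : 0 < M := by linarith
  have hL9 : 1 ≤ L ^ 9 := one_le_pow₀ hL1
  have hr0 : 0 < r := by linarith
  have hP1 : 1 ≤ P := by
    have := Real.add_one_le_exp (L ^ 9); rw [hPdef]; linarith
  have hP0 : 0 < P := by linarith
  have hT2 : 2 ≤ T := by
    have := Real.add_one_le_exp (3 * M); rw [hTdef]; linarith
  have hT0 : 0 < T := by linarith
  have hlogT : Real.log T = 3 * M := by rw [hTdef, Real.log_exp]
  have h1expL : 1 ≤ Real.exp L := Real.one_le_exp hL0.le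
  have hY0 : 0 < Y := by linarith
  have hY1 : 1 ≤ Y := by linarith
  have hlog2 : Real.log 2 ≤ 1 := by
    rw [Real.log_le_iff_le_exp (by norm_num)]; linarith [Real.add_one_le_exp (1 : ℝ)]
  have hlogY : Real.log Y ≤ 2 * L ^ 9 := by
    calc Real.log Y ≤ Real.log (2 * P) := Real.log_le_log hY0 hY2
      _ = Real.log 2 + L ^ 9 := by rw [Real.log_mul (by norm_num) hP0.ne', hPdef, Real.log_exp]
      _ ≤ 2 * L ^ 9 := by linarith
  have hlogY0 : 0 ≤ Real.log Y := Real.log_nonneg hY1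
  have hrYT1 : (1 : ℝ) ≤ r * Y * T := by
    have : (1 : ℝ) ≤ r * Y := one_le_mul_of_one_le_of_one_le (by linarith) hY1
    exact one_le_mul_of_one_le_of_one_le this (by linarith)
  have hlogRYT0 : 0 ≤ Real.log (r * Y * T) := Real.log_nonneg hrYT1
  have hlogRYT : Real.log (r * Y * T) ≤ 6 * L ^ 9 := by
    rw [Real.log_mul (by positivity) hT0.ne', Real.log_mul hr0.ne' hY0.ne', hlogT]
    linarith
  have hsq : Real.log (r * Y * T) ^ 2 ≤ 36 * L ^ 18 := by
    calc Real.log (r * Y * T) ^ 2 ≤ (6 * L ^ 9) ^ 2 := pow_le_pow_left₀ hlogRYT0 hlogRYT 2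
      _ = 36 * L ^ 18 := by ring
  have hsqrtT : Real.sqrt (9 / 4 * T) = 3 / 2 * Real.exp (3 / 2 * M) := by
    rw [Real.sqrt_mul' _ hT0.le, show (9 / 4 : ℝ) = (3 / 2) ^ 2 by norm_num,
      Real.sqrt_sq (by norm_num), hTdef, ← Real.exp_half]
    ring_nf
  have hexp32 : 0 < Real.exp (3 / 2 * M) := Real.exp_pos _
  have hTinv : T⁻¹ = Real.exp (-(3 * M)) := by rw [hTdef, Real.exp_neg]
  have he3 : Real.exp (-(3 * M)) ≤ Real.exp (-(3 / 2 * M)) := Real.exp_le_exp.2 (by linarith)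
  have he32 : (Real.exp (3 / 2 * M))⁻¹ = Real.exp (-(3 / 2 * M)) := by rw [Real.exp_neg]
  have hL918 : L ^ 9 ≤ L ^ 18 := pow_le_pow_right₀ hL1 (by norm_num)
  set F : ℝ := P * L ^ 18 * Real.exp (-(3 / 2 * M)) with hFdef
  have hF0 : 0 ≤ F := by positivity
  -- the four terms
  have h1 : (2 * K + 3) * Real.log Y ≤ (2 * K + 3) * (2 * L ^ 9) :=
    mul_le_mul_of_nonneg_left hlogY (by positivity)
  have h2 : 2 * K * (Y / T) * Real.log (r * Y * T) ^ 2 ≤ 144 * K * F := by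
    have hYT : Y / T ≤ 2 * P * Real.exp (-(3 / 2 * M)) := by
      rw [div_eq_mul_inv, hTinv]
      exact mul_le_mul hY2 he3 (Real.exp_pos _).le (by positivity)
    calc 2 * K * (Y / T) * Real.log (r * Y * T) ^ 2
        ≤ 2 * K * (2 * P * Real.exp (-(3 / 2 * M))) * (36 * L ^ 18) :=
          mul_le_mul (mul_le_mul_of_nonneg_left hYT (by positivity)) hsq (sq_nonneg _)
            (by positivity)
      _ = 144 * K * F := by rw [hFdef]; ring
  have h3 : 4 * Y * Real.log Y / Real.sqrt (9 / 4 * T) ≤ 11 * F := by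
    rw [hsqrtT, div_eq_mul_inv, mul_inv, he32]
    calc 4 * Y * Real.log Y * ((3 / 2 : ℝ)⁻¹ * Real.exp (-(3 / 2 * M)))
        ≤ 4 * (2 * P) * (2 * L ^ 9) * ((3 / 2 : ℝ)⁻¹ * Real.exp (-(3 / 2 * M))) := by
          refine mul_le_mul_of_nonneg_right ?_ (by positivity)
          exact mul_le_mul (by linarith) hlogY hlogY0 (by positivity)
      _ = (32 / 3) * (P * L ^ 9 * Real.exp (-(3 / 2 * M))) := by ring
      _ ≤ 11 * (P * L ^ 18 * Real.exp (-(3 / 2 * M))) := by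
          refine mul_le_mul (by norm_num) ?_ (by positivity) (by norm_num)
          exact mul_le_mul_of_nonneg_right (mul_le_mul_of_nonneg_left hL918 hP0.le)
            (Real.exp_pos _).le
      _ = 11 * F := by rw [hFdef]
  have h4 : Y * Real.log (r * Y * T) ^ 2 / T ≤ 72 * F := by
    rw [div_eq_mul_inv, hTinv]
    calc Y * Real.log (r * Y * T) ^ 2 * Real.exp (-(3 * M))
        ≤ (2 * P) * (36 * L ^ 18) * Real.exp (-(3 / 2 * M)) :=
          mul_le_mul (mul_le_mul hY2 hsq (sq_nonneg _) (by positivity)) he3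
            (Real.exp_pos _).le (by positivity)
      _ = 72 * F := by rw [hFdef]; ring
  have h34 : |t| * K * (4 * Y * Real.log Y / Real.sqrt (9 / 4 * T) +
      Y * Real.log (r * Y * T) ^ 2 / T) ≤ Real.exp L * K * (83 * F) := by
    refine mul_le_mul (mul_le_mul_of_nonneg_right ht' hK0) (by linarith) ?_ (by positivity)
    have : 0 ≤ 4 * Y * Real.log Y / Real.sqrt (9 / 4 * T) := by positivity
    positivity
  have h2' : 144 * K * F ≤ 144 * K * F * Real.exp L :=
    le_mul_of_one_le_right (by positivity) h1expL
  calc _ ≤ (2 * K + 3) * (2 * L ^ 9) + 144 * K * F * Real.exp L + Real.exp L * K * (83 * F) := by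
        linarith
    _ = _ := by rw [hFdef]; ring

/-- The final bookkeeping with Zhang's parameters: for `L ≥ 158`, `M = L^{9/2}`, `P = exp L⁹`
and `exp L ≥ 1848K + 72`,
`4P/L⁹ · (P L⁻⁶⁸ · 3C₀ M e^{−2M} + 2((4K+6)L⁹ + 227 K P L¹⁸ e^{L} e^{−3M/2}) + 6 √P L⁹)
  ≤ (12 C₀ + 3) P² L⁻⁷⁷ e^{−M}`. [folklore] -/
theorem units_le {K C₀ L : ℝ} (hK0 : 0 ≤ K) (hC₀ : 0 ≤ C₀) (hL158 : 158 ≤ L)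
    (hexpL : 1848 * K + 72 ≤ Real.exp L) :
    4 * (Real.exp (L ^ 9) * (L ^ 68)⁻¹ *
          (3 * C₀ * L ^ ((9 : ℝ) / 2) * Real.exp (-(2 * L ^ ((9 : ℝ) / 2)))) +
        2 * ((4 * K + 6) * L ^ 9 + 227 * K * Real.exp (L ^ 9) * L ^ 18 * Real.exp L *
          Real.exp (-(3 / 2 * L ^ ((9 : ℝ) / 2)))) +
        6 * Real.sqrt (Real.exp (L ^ 9)) * L ^ 9) * Real.exp (L ^ 9) / L ^ 9 ≤
      (12 * C₀ + 3) * Real.exp (L ^ 9) ^ 2 * (L ^ 77)⁻¹ * Real.exp (-L ^ ((9 : ℝ) / 2)) := by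
  have hL1 : 1 ≤ L := by linarith
  have hL0 : 0 < L := by linarith
  obtain ⟨hM1, hLM, hL11M, hL4M, hML9, hMM⟩ := rpow_nine_halves_facts hL1
  set M : ℝ := L ^ ((9 : ℝ) / 2) with hMdef
  set P : ℝ := Real.exp (L ^ 9) with hPdef
  have hM0 : 0 < M := by linarith
  have hP0 : 0 < P := Real.exp_pos _
  have hexpM : Real.exp L ≤ Real.exp M := Real.exp_le_exp.2 hLM
  -- unit `E₀ = P² 𝓛⁻⁷⁷ e^{−M}` and the cancellations used below
  set E₀ : ℝ := P ^ 2 * (L ^ 77)⁻¹ * Real.exp (-M) with hE₀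
  have hE₀0 : 0 < E₀ := by positivity
  have hL77 : L ^ 77 ≤ Real.exp (77 * M) := pow_le_exp_mul hL0.le hLM 77
  have hL86 : L ^ 86 ≤ Real.exp (86 * L) := pow_le_exp_mul hL0.le le_rfl 86
  have hMexp : M ≤ Real.exp M := by linarith [Real.add_one_le_exp M]
  have h77 : L ^ 77 * (L ^ 77)⁻¹ = 1 := mul_inv_cancel₀ (by positivity)
  have hEE : Real.exp M * Real.exp (-M) = 1 := by
    rw [← Real.exp_add, add_neg_cancel, Real.exp_zero]
  -- (a) the zero-sum part: `4P/L⁹ · P L⁻⁶⁸ · 3C₀ M e^{−2M} ≤ 12 C₀ E₀`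
  have ha : 4 * (P * (L ^ 68)⁻¹ * (3 * C₀ * M * Real.exp (-(2 * M)))) * P / L ^ 9 ≤
      12 * C₀ * E₀ := by
    have hMe : M * Real.exp (-(2 * M)) ≤ Real.exp (-M) := by
      have h := mul_le_mul_of_nonneg_right hMexp (Real.exp_pos (-(2 * M))).le
      rw [← Real.exp_add] at h
      have : M + -(2 * M) = -M := by ring
      rwa [this] at h
    have hpow : (L ^ 68)⁻¹ / L ^ 9 = (L ^ 77)⁻¹ := by
      rw [div_eq_mul_inv, ← mul_inv, ← pow_add]
    calc 4 * (P * (L ^ 68)⁻¹ * (3 * C₀ * M * Real.exp (-(2 * M)))) * P / L ^ 9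
        = 12 * C₀ * (P ^ 2 * ((L ^ 68)⁻¹ / L ^ 9) * (M * Real.exp (-(2 * M)))) := by ring
      _ ≤ 12 * C₀ * (P ^ 2 * ((L ^ 68)⁻¹ / L ^ 9) * Real.exp (-M)) := by
          refine mul_le_mul_of_nonneg_left (mul_le_mul_of_nonneg_left hMe ?_) (by positivity)
          positivity
      _ = 12 * C₀ * E₀ := by rw [hpow, hE₀]
  -- (b) `4P/L⁹ · 2(4K+6)L⁹ = (32K+48) P ≤ E₀`, since `(32K+48) L⁷⁷ e^{M} ≤ e^{79M} ≤ e^{M²} = P`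
  have hb : 4 * (2 * ((4 * K + 6) * L ^ 9)) * P / L ^ 9 ≤ E₀ := by
    have e1 : 4 * (2 * ((4 * K + 6) * L ^ 9)) * P / L ^ 9 = (32 * K + 48) * P := by
      rw [div_eq_iff (by positivity)]; ring
    rw [e1, hE₀]
    have hKe : 32 * K + 48 ≤ Real.exp M := by linarith
    have hmain : (32 * K + 48) * L ^ 77 * Real.exp M ≤ P := by
      calc (32 * K + 48) * L ^ 77 * Real.exp M
          ≤ Real.exp M * Real.exp (77 * M) * Real.exp M :=
            mul_le_mul_of_nonneg_right (mul_le_mul hKe hL77 (by positivity) (Real.exp_pos _).le)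
              (Real.exp_pos _).le
        _ = Real.exp (79 * M) := by rw [← Real.exp_add, ← Real.exp_add]; ring_nf
        _ ≤ Real.exp (M * M) := Real.exp_le_exp.2 (by nlinarith)
        _ = P := by rw [hMM, hPdef]
    calc (32 * K + 48) * P
        = (32 * K + 48) * P * (L ^ 77 * (L ^ 77)⁻¹) * (Real.exp M * Real.exp (-M)) := by
          rw [h77, hEE]; ring
      _ = ((32 * K + 48) * L ^ 77 * Real.exp M) * (P * ((L ^ 77)⁻¹ * Real.exp (-M))) := by ring
      _ ≤ P * (P * ((L ^ 77)⁻¹ * Real.exp (-M))) :=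
          mul_le_mul_of_nonneg_right hmain (by positivity)
      _ = P ^ 2 * (L ^ 77)⁻¹ * Real.exp (-M) := by ring
  -- (c) `4P/L⁹ · 2·227 K P L¹⁸ e^{L} e^{−3M/2} ≤ E₀`, since `1816 K L⁸⁶ e^{L} ≤ e^{88L} ≤ e^{M/2}`
  have hc : 4 * (2 * (227 * K * P * L ^ 18 * Real.exp L * Real.exp (-(3 / 2 * M)))) * P / L ^ 9
      ≤ E₀ := by
    have e1 : 4 * (2 * (227 * K * P * L ^ 18 * Real.exp L * Real.exp (-(3 / 2 * M)))) * P / L ^ 9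
        = 1816 * K * P ^ 2 * L ^ 9 * Real.exp L * Real.exp (-(3 / 2 * M)) := by
      rw [div_eq_iff (by positivity)]; ring
    rw [e1, hE₀]
    have hKe : 1816 * K ≤ Real.exp L := by linarith
    have h176 : 176 * L ≤ M := by
      have h3 : (158 : ℝ) ^ 3 ≤ L ^ 3 := pow_le_pow_left₀ (by norm_num) hL158 3
      have : 176 * L ≤ L ^ 4 := by nlinarith
      linarith
    have hmain : 1816 * K * L ^ 86 * Real.exp L ≤ Real.exp (M / 2) := by
      calc 1816 * K * L ^ 86 * Real.exp L ≤ Real.exp L * Real.exp (86 * L) * Real.exp L :=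
            mul_le_mul_of_nonneg_right (mul_le_mul hKe hL86 (by positivity) (Real.exp_pos _).le)
              (Real.exp_pos _).le
        _ = Real.exp (88 * L) := by rw [← Real.exp_add, ← Real.exp_add]; ring_nf
        _ ≤ Real.exp (M / 2) := Real.exp_le_exp.2 (by linarith)
    have hexpM2 : 0 < Real.exp (M / 2) := Real.exp_pos _
    have hB1 : 1816 * K * L ^ 86 * Real.exp L * (Real.exp (M / 2))⁻¹ ≤ 1 := by
      rw [mul_inv_le_iff₀ hexpM2, one_mul]; exact hmain
    have hsplit : Real.exp (-(3 / 2 * M)) = Real.exp (-M) * (Real.exp (M / 2))⁻¹ := by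
      rw [← Real.exp_neg, ← Real.exp_add]; ring_nf
    have hpow : (L ^ 77)⁻¹ * L ^ 86 = L ^ 9 := by
      rw [inv_mul_eq_iff_eq_mul₀ (by positivity), ← pow_add]
    calc 1816 * K * P ^ 2 * L ^ 9 * Real.exp L * Real.exp (-(3 / 2 * M))
        = (1816 * K * L ^ 86 * Real.exp L * (Real.exp (M / 2))⁻¹) *
            (P ^ 2 * (L ^ 77)⁻¹ * Real.exp (-M)) := by
          rw [hsplit, ← hpow]; ring
      _ ≤ 1 * (P ^ 2 * (L ^ 77)⁻¹ * Real.exp (-M)) :=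
          mul_le_mul_of_nonneg_right hB1 (by positivity)
      _ = P ^ 2 * (L ^ 77)⁻¹ * Real.exp (-M) := one_mul _
  -- (d) `4P/L⁹ · 6 √P L⁹ = 24 P^{3/2} ≤ E₀`, since `24 L⁷⁷ e^{M} ≤ e^{79M} ≤ e^{L⁹/2} = √P`
  have hd : 4 * (6 * Real.sqrt P * L ^ 9) * P / L ^ 9 ≤ E₀ := by
    have e1 : 4 * (6 * Real.sqrt P * L ^ 9) * P / L ^ 9 = 24 * Real.sqrt P * P := by
      rw [div_eq_iff (by positivity)]; ring
    rw [e1, hE₀]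
    have h24 : (24 : ℝ) ≤ Real.exp M := by linarith
    have hsqrtP : Real.sqrt P = Real.exp (L ^ 9 / 2) := by rw [hPdef, Real.exp_half]
    have hmain : 24 * L ^ 77 * Real.exp M ≤ Real.sqrt P := by
      calc 24 * L ^ 77 * Real.exp M ≤ Real.exp M * Real.exp (77 * M) * Real.exp M :=
            mul_le_mul_of_nonneg_right (mul_le_mul h24 hL77 (by positivity) (Real.exp_pos _).le)
              (Real.exp_pos _).le
        _ = Real.exp (79 * M) := by rw [← Real.exp_add, ← Real.exp_add]; ring_nf
        _ ≤ Real.exp (L ^ 9 / 2) := Real.exp_le_exp.2 (by rw [← hMM]; nlinarith)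
        _ = Real.sqrt P := hsqrtP.symm
    have hPsq : Real.sqrt P * Real.sqrt P = P := Real.mul_self_sqrt hP0.le
    calc 24 * Real.sqrt P * P
        = 24 * Real.sqrt P * P * (L ^ 77 * (L ^ 77)⁻¹) * (Real.exp M * Real.exp (-M)) := by
          rw [h77, hEE]; ring
      _ = (24 * L ^ 77 * Real.exp M) * (Real.sqrt P * P * ((L ^ 77)⁻¹ * Real.exp (-M))) := by
          ring
      _ ≤ Real.sqrt P * (Real.sqrt P * P * ((L ^ 77)⁻¹ * Real.exp (-M))) :=
          mul_le_mul_of_nonneg_right hmain (by positivity)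
      _ = (Real.sqrt P * Real.sqrt P) * P * (L ^ 77)⁻¹ * Real.exp (-M) := by ring
      _ = P ^ 2 * (L ^ 77)⁻¹ * Real.exp (-M) := by rw [hPsq]; ring
  have hsum : 4 * (P * (L ^ 68)⁻¹ * (3 * C₀ * M * Real.exp (-(2 * M))) +
      2 * ((4 * K + 6) * L ^ 9 + 227 * K * P * L ^ 18 * Real.exp L * Real.exp (-(3 / 2 * M))) +
      6 * Real.sqrt P * L ^ 9) * P / L ^ 9 =
      4 * (P * (L ^ 68)⁻¹ * (3 * C₀ * M * Real.exp (-(2 * M)))) * P / L ^ 9 +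
      (4 * (2 * ((4 * K + 6) * L ^ 9)) * P / L ^ 9 +
        4 * (2 * (227 * K * P * L ^ 18 * Real.exp L * Real.exp (-(3 / 2 * M)))) * P / L ^ 9) +
      4 * (6 * Real.sqrt P * L ^ 9) * P / L ^ 9 := by
    ring
  rw [hsum]
  calc _ ≤ 12 * C₀ * E₀ + (E₀ + E₀) + E₀ := by linarith [ha, hb, hc, hd]
    _ = (12 * C₀ + 3) * E₀ := by ring
    _ = (12 * C₀ + 3) * P ^ 2 * (L ^ 77)⁻¹ * Real.exp (-M) := by rw [hE₀]; ring

/-! ### Lemma 5.6 -/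

set_option maxHeartbeats 1600000 in
/-- **Zhang 2022, Lemma 5.6 (twist `p^{-it} · p`).** There are `D₀ : ℕ` and `C > 0` such that for
every `D ≥ D₀`, every `χ ≠ χ₀` mod `D` with (A) `‖L(1, χ)‖ < (log D)⁻²⁰²²`, every `1 < r` with
`r < exp((log D)^{11/10})`, every primitive `θ` mod `r` different from `χ` as a character mod `Dr`,
every real `t` with `|t| ≤ D` and every `u` with `P ≤ u ≤ P(1 + (log D)⁻⁶⁸)`, `P = exp((log D)⁹)`:
`‖∑_{P < p ≤ u, p prime} θ(p) p^{-it} p‖ ≤ C P² (log D)⁻⁷⁷ exp(−(log D)^{9/2})`.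
[cite: Zhang2022LandauSiegel, Lemma 5.6, p. 11] [cite: MontgomeryVaughan2007, Theorems 10.17,
11.3, 11.7, 12.10] [cite: Linnik1944] [cite: Bombieri1987GrandCrible, §6 Théorème 14, p. 55] -/
theorem lemma56_twist :
    ∃ D₀ : ℕ, ∃ C : ℝ, 0 < C ∧ ∀ (D : ℕ) [NeZero D], D₀ ≤ D → ∀ χ : DirichletCharacter ℂ D, χ ≠ 1 →
      ‖χ.LFunction 1‖ < (Real.log D ^ 2022)⁻¹ →
      ∀ (r : ℕ) [NeZero r], 1 < r → (r : ℝ) < Real.exp (Real.log D ^ ((11 : ℝ) / 10)) →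
      ∀ θ : DirichletCharacter ℂ r, θ.IsPrimitive →
        changeLevel (Nat.dvd_mul_left r D) θ ≠ changeLevel (Nat.dvd_mul_right D r) χ →
      ∀ t : ℝ, |t| ≤ D → ∀ u : ℝ, Real.exp (Real.log D ^ 9) ≤ u →
        u ≤ Real.exp (Real.log D ^ 9) * (1 + (Real.log D ^ 68)⁻¹) →
        ‖∑ p ∈ (Finset.Ioc ⌊Real.exp (Real.log D ^ 9)⌋₊ ⌊u⌋₊).filter Nat.Prime,
            θ p * ((p : ℂ) ^ (-(t * I)) * p)‖ ≤
          C * Real.exp (Real.log D ^ 9) ^ 2 * (Real.log D ^ 77)⁻¹ *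
            Real.exp (-(Real.log D ^ ((9 : ℝ) / 2))) := by
  classical
  -- the constants
  obtain ⟨K', hK'⟩ := truncatedExplicitFormula_psiChar_holds 2 one_lt_two
  set K : ℝ := max K' 0 with hKdef
  have hK0 : 0 ≤ K := le_max_right _ _
  have hEF : ∀ (q : ℕ) [NeZero q], 1 < q → ∀ χ : DirichletCharacter ℂ q, χ.IsPrimitive →
      ∀ y : ℝ, 2 ≤ y → ∀ T : ℝ, 2 ≤ T →
        ‖chebyshevPsiChar₀ χ y - (-charZeroSumTrunc χ y T - 1 / 2 * Real.log (y - 1) -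
            χ (-1) / 2 * Real.log (y + 1) + explicitFormulaConst χ)‖ ≤
          K * (Real.log y * min 1 (y / (T * primePowDist y)) + y / T * Real.log (q * y * T) ^ 2) := by
    intro q _ hq χ hprim y hy T hT
    refine (hK' q hq χ hprim y hy T hT).trans (mul_le_mul_of_nonneg_right (le_max_left _ _) ?_)
    have : 0 ≤ min 1 (y / (T * primePowDist y)) :=
      le_min zero_le_one (div_nonneg (by linarith) (mul_nonneg (by linarith) (primePowDist_nonneg y)))
    have : 0 ≤ Real.log y := Real.log_nonneg (by linarith)
    positivity
  obtain ⟨C₀, hC₀, HZ⟩ := exists_zeroSum_le_of_strip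
  obtain ⟨c₁, c₂, hc₁, hc₂, HDH⟩ := deuring_heilbronn_twoModuli
  obtain ⟨cE, hcE, HE⟩ := exists_LFunction_exceptionalPoint_ne_zero
  obtain ⟨D₁, K₁, hK₁, c', -, H55⟩ := lemma55_exceptionalZero
  -- how large `𝓛 = log D` must be
  set Lstar : ℝ := max (max 158 (Real.log (1848 * K + 72)))
    (max (4 * K₁ / cE + 1) (6 * K₁ / c₁ * Real.exp (30 / c₂))) with hLstar
  obtain ⟨D₂, hD₂⟩ := exists_nat_le_log' Lstar
  refine ⟨max D₁ D₂, 12 * C₀ + 3, by positivity,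
    fun D _ hD χ hχ hA r _ hr1 hrT θ hprim hne t ht u hPu huP ↦ ?_⟩
  -- notation
  set L : ℝ := Real.log D with hLdef
  set M : ℝ := L ^ ((9 : ℝ) / 2) with hMdef
  set P : ℝ := Real.exp (L ^ 9) with hPdef
  set T : ℝ := Real.exp (3 * M) with hTdef
  have hLs : Lstar ≤ L := hD₂ D (le_trans (le_max_right _ _) hD)
  have hL158 : 158 ≤ L := le_trans (le_trans (le_max_left _ _) (le_max_left _ _)) hLs
  have hLK : Real.log (1848 * K + 72) ≤ L := le_trans (le_trans (le_max_right _ _) (le_max_left _ _)) hLs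
  have hLE : 4 * K₁ / cE + 1 ≤ L := le_trans (le_trans (le_max_left _ _) (le_max_right _ _)) hLs
  have hLc : 6 * K₁ / c₁ * Real.exp (30 / c₂) ≤ L :=
    le_trans (le_trans (le_max_right _ _) (le_max_right _ _)) hLs
  have hL1 : 1 ≤ L := by linarith
  have hL0 : 0 < L := by linarith
  obtain ⟨hM1, hLM, hL11M, hL4M, hML9, hMM⟩ := rpow_nine_halves_facts hL1
  simp only [← hMdef] at hM1 hLM hL11M hL4M hML9 hMM
  have hM0 : 0 < M := by linarith
  have hMne : M ≠ 0 := hM0.ne'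
  have hL9 : 1 ≤ L ^ 9 := one_le_pow₀ hL1
  have hD0 : (0 : ℝ) < D := by exact_mod_cast Nat.pos_of_neZero D
  have hD1 : (1 : ℝ) ≤ D := by exact_mod_cast Nat.pos_of_neZero D
  have hDexp : (D : ℝ) = Real.exp L := by rw [hLdef, Real.exp_log hD0]
  have hr2 : (2 : ℝ) ≤ r := by exact_mod_cast hr1
  have hr0 : (0 : ℝ) < r := by linarith
  -- `exp L ≥ 1848 K + 72`
  have hexpL : 1848 * K + 72 ≤ Real.exp L := by
    have := Real.exp_le_exp.2 hLK
    rwa [Real.exp_log (by positivity)] at this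
  have hexpM : Real.exp L ≤ Real.exp M := Real.exp_le_exp.2 hLM
  have h1expL : 1 ≤ Real.exp L := by linarith
  -- `P`, `T`
  have hP1 : 1 ≤ P := by
    have := Real.add_one_le_exp (L ^ 9); rw [hPdef]; linarith
  have hP3 : 3 ≤ P := by
    have := Real.add_one_le_exp (L ^ 9)
    have : (2 : ℝ) ≤ L ^ 9 := by nlinarith [one_le_pow₀ (n := 8) hL1]
    rw [hPdef]; linarith
  have hP0 : 0 < P := by linarith
  have hT6 : 6 ≤ T := by
    have := Real.add_one_le_exp (3 * M); rw [hTdef]; linarith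
  have hT2 : 2 ≤ T := by linarith
  have hT0 : 0 < T := by linarith
  have hlogT : Real.log T = 3 * M := by rw [hTdef, Real.log_exp]
  have hlogr : Real.log r ≤ M := by
    have h := (Real.log_lt_iff_lt_exp hr0).2 hrT
    exact (h.le.trans hL11M)
  have hrT' : (r : ℝ) ≤ T := by
    refine hrT.le.trans ?_
    rw [hTdef]; exact Real.exp_le_exp.2 (by linarith)
  -- the exceptional zero
  obtain ⟨β₁, hβ₁1, hz₁, -, hsq, hK₁β, -, -, -⟩ := H55 D (le_trans (le_max_left _ _) hD) χ hχ hA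
  rw [← hLdef] at hK₁β
  have h1β : 0 < 1 - β₁ := by linarith
  have hθ1 : θ ≠ 1 := ne_one_of_isPrimitive hprim hr1
  -- `K₁ 𝓛⁻²⁰²² · (6M) ≤ c₁` and `K₁ 𝓛⁻²⁰²² · (4M) < cE`
  have hKL : K₁ * (L ^ 2022)⁻¹ * M ≤ K₁ / L := by
    have h1 : (L ^ 2022)⁻¹ * M ≤ L⁻¹ := by
      rw [inv_mul_le_iff₀ (by positivity)]
      calc M ≤ L ^ 9 := hML9
        _ ≤ L ^ 2021 := pow_le_pow_right₀ hL1 (by norm_num)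
        _ = L ^ 2022 * L⁻¹ := by
            rw [show L ^ 2022 = L ^ 2021 * L from pow_succ L 2021, mul_inv_cancel_right₀ hL0.ne']
    calc K₁ * (L ^ 2022)⁻¹ * M = K₁ * ((L ^ 2022)⁻¹ * M) := by ring
      _ ≤ K₁ * L⁻¹ := mul_le_mul_of_nonneg_left h1 hK₁.le
      _ = K₁ / L := (div_eq_mul_inv _ _).symm
  have hNeedA : (1 - β₁) * (6 * M) ≤ c₁ := by
    have h6 : 6 * K₁ / c₁ ≤ L := by
      have : 6 * K₁ / c₁ ≤ 6 * K₁ / c₁ * Real.exp (30 / c₂) :=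
        le_mul_of_one_le_right (by positivity) (Real.one_le_exp (by positivity))
      linarith
    have h6' : 6 * (K₁ / L) ≤ c₁ := by
      rw [div_le_iff₀ hc₁] at h6
      rw [mul_div_assoc', div_le_iff₀ hL0]; linarith
    calc (1 - β₁) * (6 * M) ≤ K₁ * (L ^ 2022)⁻¹ * (6 * M) :=
          mul_le_mul_of_nonneg_right hK₁β (by positivity)
      _ = 6 * (K₁ * (L ^ 2022)⁻¹ * M) := by ring
      _ ≤ 6 * (K₁ / L) := by linarith
      _ ≤ c₁ := h6'
  have hNeedF : (1 - β₁) * (4 * M) < cE := by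
    have h4 : 4 * K₁ / cE < L := by linarith
    have h4' : 4 * (K₁ / L) < cE := by
      rw [div_lt_iff₀ hcE] at h4
      rw [mul_div_assoc', div_lt_iff₀ hL0]; linarith
    calc (1 - β₁) * (4 * M) ≤ K₁ * (L ^ 2022)⁻¹ * (4 * M) :=
          mul_le_mul_of_nonneg_right hK₁β (by positivity)
      _ = 4 * (K₁ * (L ^ 2022)⁻¹ * M) := by ring
      _ ≤ 4 * (K₁ / L) := by linarith
      _ < cE := h4'
  have hlog4 : Real.log 4 < 2 := by
    rw [Real.log_lt_iff_lt_exp (by norm_num)]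
    have h1 := Real.exp_one_gt_d9
    have h2 : Real.exp 2 = Real.exp 1 * Real.exp 1 := by rw [← Real.exp_add]; norm_num
    nlinarith
  have hlogDr : Real.log ((D : ℝ) * r) ≤ 2 * M := by
    rw [Real.log_mul hD0.ne' hr0.ne']; linarith
  -- Step 1: the zero-free strip `Re ρ ≤ 1 − η` up to height `T`
  set η : ℝ := c₂ * Real.log (c₁ / ((1 - β₁) * (6 * M))) / (6 * M) with hηdef
  have hstrip : ∀ ρ ∈ lfunctionZeroBox θ T, ρ.re ≤ 1 - η := by
    intro ρ hρ
    obtain ⟨hρ0, hre0, hre1, him⟩ := mem_lfunctionZeroBox.1 hρ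
    have hne' : ρ ≠ (β₁ : ℂ) := by
      intro h
      have hzθ : θ.LFunction β₁ = 0 := by rw [← h]; exact hρ0
      refine HE D r χ θ hχ hsq hθ1 hne β₁ hz₁ ?_ hzθ
      have hden : 0 < Real.log ((D : ℝ) * r) + Real.log 4 := by
        have : 0 ≤ Real.log ((D : ℝ) * r) := Real.log_nonneg (by nlinarith)
        have : 0 < Real.log 4 := Real.log_pos (by norm_num)
        linarith
      have hden4 : Real.log ((D : ℝ) * r) + Real.log 4 ≤ 4 * M := by linarith
      have h1 : cE / (4 * M) ≤ cE / (Real.log ((D : ℝ) * r) + Real.log 4) :=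
        div_le_div_of_nonneg_left hcE.le hden hden4
      have h2 : 1 - β₁ < cE / (4 * M) := by
        rw [lt_div_iff₀ (by positivity)]; exact hNeedF
      linarith
    have hdh := HDH D r χ hsq β₁ hβ₁1 hz₁ θ ρ hρ0 hre0 hre1 hne'
    -- the logarithm `ℓ = log(Dr(2 + |γ|)) ≤ 6M`
    have harg : (2 : ℝ) ≤ (D : ℝ) * r * (2 + |ρ.im|) := by
      have h1 : (1 : ℝ) * 2 * 2 ≤ (D : ℝ) * r * (2 + |ρ.im|) :=
        mul_le_mul (mul_le_mul hD1 hr2 (by norm_num) (by linarith))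
          (by linarith [abs_nonneg ρ.im]) (by norm_num) (by positivity)
      linarith
    have hℓ0 : 0 < Real.log ((D : ℝ) * r * (2 + |ρ.im|)) := Real.log_pos (by linarith)
    have hℓ6 : Real.log ((D : ℝ) * r * (2 + |ρ.im|)) ≤ 6 * M := by
      have hγ : 2 + |ρ.im| ≤ Real.exp (3 * M + 1) := by
        have he : Real.exp (3 * M + 1) = Real.exp 1 * T := by rw [Real.exp_add, hTdef, mul_comm]
        rw [he]
        have hT' : |ρ.im| ≤ T := him
        nlinarith [Real.exp_one_gt_d9]
      have hub : (D : ℝ) * r * (2 + |ρ.im|) ≤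
          Real.exp L * Real.exp (L ^ ((11 : ℝ) / 10)) * Real.exp (3 * M + 1) := by
        rw [hDexp]
        exact mul_le_mul (mul_le_mul_of_nonneg_left hrT.le (Real.exp_pos _).le) hγ
          (by positivity) (by positivity)
      calc Real.log ((D : ℝ) * r * (2 + |ρ.im|))
          ≤ Real.log (Real.exp L * Real.exp (L ^ ((11 : ℝ) / 10)) * Real.exp (3 * M + 1)) :=
            Real.log_le_log (by linarith) hub
        _ = L + L ^ ((11 : ℝ) / 10) + (3 * M + 1) := by
            rw [Real.log_mul (by positivity) (by positivity), Real.log_mul (by positivity)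
              (by positivity), Real.log_exp, Real.log_exp, Real.log_exp]
        _ ≤ 6 * M := by linarith
    have hmono := dh_bound_mono hc₂.le h1β hℓ0 hℓ6 hNeedA
    linarith
  -- Step 2: the zero sum `∑ m(ρ) P^{β−1} ≤ 3 C₀ M e^{−2M}`
  have hη5 : 5 / M ≤ η := by
    -- `c₁/((1−β₁)6M) ≥ (c₁/6K₁) L ≥ exp(30/c₂)`
    have hq0 : 0 < (1 - β₁) * (6 * M) := by positivity
    have hlow : Real.exp (30 / c₂) ≤ c₁ / ((1 - β₁) * (6 * M)) := by
      rw [le_div_iff₀ hq0]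
      have h1 : (1 - β₁) * (6 * M) ≤ 6 * (K₁ / L) := by
        calc (1 - β₁) * (6 * M) ≤ K₁ * (L ^ 2022)⁻¹ * (6 * M) :=
              mul_le_mul_of_nonneg_right hK₁β (by positivity)
          _ = 6 * (K₁ * (L ^ 2022)⁻¹ * M) := by ring
          _ ≤ 6 * (K₁ / L) := by linarith
      have h2 : Real.exp (30 / c₂) * (6 * (K₁ / L)) ≤ c₁ := by
        rw [div_mul_eq_mul_div, div_le_iff₀ hc₁] at hLc
        -- hLc : 6 * K₁ * exp(30/c₂) ≤ L * c₁
        rw [show Real.exp (30 / c₂) * (6 * (K₁ / L)) = 6 * K₁ * Real.exp (30 / c₂) / L by ring,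
          div_le_iff₀ hL0]
        linarith
      calc Real.exp (30 / c₂) * ((1 - β₁) * (6 * M)) ≤ Real.exp (30 / c₂) * (6 * (K₁ / L)) :=
            mul_le_mul_of_nonneg_left h1 (Real.exp_pos _).le
        _ ≤ c₁ := h2
    have hlog30 : 30 / c₂ ≤ Real.log (c₁ / ((1 - β₁) * (6 * M))) := by
      rw [Real.le_log_iff_exp_le (lt_of_lt_of_le (Real.exp_pos _) hlow)]; exact hlow
    rw [hηdef, le_div_iff₀ (by positivity)]
    have h30 := mul_le_mul_of_nonneg_left hlog30 hc₂.le
    have e30 : c₂ * (30 / c₂) = 30 := by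
      calc c₂ * (30 / c₂) = 30 * (c₂ / c₂) := by ring
        _ = 30 := by rw [div_self hc₂.ne', mul_one]
    rw [e30] at h30
    calc 5 / M * (6 * M) = 30 * (M / M) := by ring
      _ = 30 := by rw [div_self hMne, mul_one]
      _ ≤ c₂ * Real.log (c₁ / ((1 - β₁) * (6 * M))) := h30
  have hZS := HZ r θ hprim hr1 T hT6 hrT' η P hP1 hstrip
  have hPη : P ^ (-η) ≤ Real.exp (-(5 * M)) := by
    have h1 : P ^ (-η) ≤ P ^ (-(5 / M)) := Real.rpow_le_rpow_of_exponent_le hP1 (by linarith)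
    have h2 : P ^ (-(5 / M)) = Real.exp (-(5 * M)) := by
      rw [hPdef, ← Real.exp_mul, ← hMM]
      congr 1
      calc M * M * -(5 / M) = -(5 * (M * (M / M))) := by ring
        _ = -(5 * M) := by rw [div_self hMne, mul_one]
    exact h1.trans_eq h2
  have hZS' : ∑ ρ ∈ (lfunctionZeroBox_finite (ne_one_of_isPrimitive hprim hr1) T).toFinset,
      (DirichletDisc.zeroOrder θ ρ : ℝ) * P ^ (ρ.re - 1) ≤ 3 * C₀ * M * Real.exp (-(2 * M)) := by
    refine hZS.trans ?_
    rw [hlogT]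
    have he : T * Real.exp (-(5 * M)) = Real.exp (-(2 * M)) := by
      rw [hTdef, ← Real.exp_add]; ring_nf
    calc C₀ * T * (3 * M) * P ^ (-η) ≤ C₀ * T * (3 * M) * Real.exp (-(5 * M)) :=
          mul_le_mul_of_nonneg_left hPη (by positivity)
      _ = 3 * C₀ * M * (T * Real.exp (-(5 * M))) := by ring
      _ = 3 * C₀ * M * Real.exp (-(2 * M)) := by rw [he]
  have hZS0 : 0 ≤ ∑ ρ ∈ (lfunctionZeroBox_finite (ne_one_of_isPrimitive hprim hr1) T).toFinset,
      (DirichletDisc.zeroOrder θ ρ : ℝ) * P ^ (ρ.re - 1) :=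
    Finset.sum_nonneg fun ρ _ ↦ mul_nonneg (Nat.cast_nonneg _) (Real.rpow_nonneg hP0.le _)
  -- Step 3: the remainder terms `R(Y)` for `P ≤ Y ≤ 2P`
  set E : ℝ := (4 * K + 6) * L ^ 9 + 227 * K * P * L ^ 18 * Real.exp L * Real.exp (-(3 / 2 * M))
    with hEdef
  have hE0 : 0 ≤ E := by positivity
  have ht' : |t| ≤ Real.exp L := ht.trans (le_of_eq hDexp)
  have hR : ∀ Y : ℝ, P ≤ Y → Y ≤ 2 * P →
      (2 * K + 3) * Real.log Y + 2 * K * (Y / T) * Real.log (r * Y * T) ^ 2 +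
        |t| * K * (4 * Y * Real.log Y / Real.sqrt (9 / 4 * T) + Y * Real.log (r * Y * T) ^ 2 / T)
        ≤ E := by
    intro Y hPY hY2
    have h := remainder_le hK0 hL1 hr2 hlogr ht' hPY hY2
    simp only [← hMdef, ← hPdef, ← hTdef] at h
    rw [hEdef]
    exact h
  -- Step 4: the window bound for every integer endpoint `N`, `P < N ≤ P(1 + 𝓛⁻⁶⁸)`
  set MA : ℝ := P * (L ^ 68)⁻¹ * (3 * C₀ * M * Real.exp (-(2 * M))) + 2 * E +
    6 * Real.sqrt P * L ^ 9 with hMAdef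
  have hMA0 : 0 ≤ MA := by positivity
  have hP2 : P * (1 + (L ^ 68)⁻¹) ≤ 2 * P := by
    have : (L ^ 68)⁻¹ ≤ 1 := inv_le_one_of_one_le₀ (one_le_pow₀ hL1)
    nlinarith
  have hWin : ∀ N : ℕ, ⌊P⌋₊ < N → (N : ℝ) ≤ P * (1 + (L ^ 68)⁻¹) →
      ‖∑ p ∈ (Finset.Ioc ⌊P⌋₊ N).filter Nat.Prime,
        θ p * (p : ℂ) ^ (-(t * I)) * (Real.log p : ℂ)‖ ≤ MA := by
    intro N hN hNP
    have hPN : P ≤ N := by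
      have h1 := Nat.lt_floor_add_one P
      have h2 : ((⌊P⌋₊ + 1 : ℕ) : ℝ) ≤ N := by exact_mod_cast hN
      push_cast at h2; linarith
    have hN2P : (N : ℝ) ≤ 2 * P := hNP.trans hP2
    have hN1 : 1 ≤ N := by
      have : (1 : ℝ) ≤ N := hP1.trans hPN
      exact_mod_cast this
    have hw := norm_windowSum_vonMangoldt_le hK0 hEF hprim hr1 t hP3 hPN hT2
    rw [Nat.floor_natCast] at hw
    have hpp := norm_windowSum_sub_primeSum_le θ t (a := ⌊P⌋₊) hN1
    -- the pieces of `hw`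
    have hzero : ((N : ℝ) - P) *
        ∑ ρ ∈ (lfunctionZeroBox_finite (ne_one_of_isPrimitive hprim hr1) T).toFinset,
          (DirichletDisc.zeroOrder θ ρ : ℝ) * P ^ (ρ.re - 1) ≤
        P * (L ^ 68)⁻¹ * (3 * C₀ * M * Real.exp (-(2 * M))) := by
      refine mul_le_mul ?_ hZS' hZS0 (by positivity)
      have : (N : ℝ) ≤ P + P * (L ^ 68)⁻¹ := by linarith
      linarith
    have hRN := hR N hPN hN2P
    have hRP := hR P le_rfl (by linarith)
    have hsqrtN : 2 * Real.sqrt N * Real.log N ≤ 6 * Real.sqrt P * L ^ 9 := by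
      have hs2 : Real.sqrt 2 ≤ 3 / 2 := by
        rw [Real.sqrt_le_left (by norm_num)]; norm_num
      have hsN : Real.sqrt N ≤ 3 / 2 * Real.sqrt P := by
        calc Real.sqrt N ≤ Real.sqrt (2 * P) := Real.sqrt_le_sqrt hN2P
          _ = Real.sqrt 2 * Real.sqrt P := Real.sqrt_mul (by norm_num) P
          _ ≤ 3 / 2 * Real.sqrt P := mul_le_mul_of_nonneg_right hs2 (Real.sqrt_nonneg _)
      have hN0 : (0 : ℝ) < N := by linarith
      have hlogN : Real.log N ≤ 2 * L ^ 9 := by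
        have hlog2 : Real.log 2 ≤ 1 := by
          rw [Real.log_le_iff_le_exp (by norm_num)]; linarith [Real.add_one_le_exp (1 : ℝ)]
        calc Real.log N ≤ Real.log (2 * P) := Real.log_le_log hN0 hN2P
          _ = Real.log 2 + L ^ 9 := by
              rw [Real.log_mul (by norm_num) hP0.ne', hPdef, Real.log_exp]
          _ ≤ 2 * L ^ 9 := by linarith
      have hlogN0 : 0 ≤ Real.log N := Real.log_nonneg (by linarith)
      calc 2 * Real.sqrt N * Real.log N ≤ 2 * (3 / 2 * Real.sqrt P) * (2 * L ^ 9) :=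
            mul_le_mul (mul_le_mul_of_nonneg_left hsN (by norm_num)) hlogN hlogN0 (by positivity)
        _ = 6 * Real.sqrt P * L ^ 9 := by ring
    set A : ℂ := ∑ n ∈ Finset.Ioc ⌊P⌋₊ N, θ n * Λ n * (n : ℂ) ^ (-(t * I)) with hAdef
    set B : ℂ := ∑ p ∈ (Finset.Ioc ⌊P⌋₊ N).filter Nat.Prime,
      θ p * (p : ℂ) ^ (-(t * I)) * (Real.log p : ℂ) with hBdef
    have htri : ‖B‖ ≤ ‖A‖ + 2 * Real.sqrt N * Real.log N := by
      calc ‖B‖ = ‖A - (A - B)‖ := by rw [sub_sub_cancel]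
        _ ≤ ‖A‖ + ‖A - B‖ := norm_sub_le _ _
        _ ≤ ‖A‖ + 2 * Real.sqrt N * Real.log N := by linarith [hpp]
    linarith [hw, hzero, hRN, hRP, hsqrtN, htri]
  -- Step 5: discrete Abel summation with the weight `p/log p`
  have hfinal_unit : 4 * MA * P / L ^ 9 ≤
      (12 * C₀ + 3) * P ^ 2 * (L ^ 77)⁻¹ * Real.exp (-M) := by
    have h := units_le hK0 hC₀.le hL158 hexpL
    simp only [← hMdef, ← hPdef] at h
    rw [hMAdef, hEdef]
    exact h
  -- the sum itself
  set a : ℕ := ⌊P⌋₊ with hadef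
  set b : ℕ := ⌊u⌋₊ with hbdef
  have hu0 : 0 ≤ u := hP0.le.trans hPu
  rcases le_or_gt b a with hba | hab
  · have hempty : (Finset.Ioc a b).filter Nat.Prime = ∅ := by
      rw [Finset.filter_eq_empty_iff]
      intro n hn; rw [Finset.mem_Ioc] at hn; omega
    rw [hempty, Finset.sum_empty, norm_zero]
    positivity
  set c : ℕ → ℂ := fun n ↦ if n.Prime then θ n * (n : ℂ) ^ (-(t * I)) * (Real.log n : ℂ) else 0
    with hcdef
  set g : ℕ → ℝ := fun n ↦ (n : ℝ) / Real.log n with hgdef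
  have hident : ∑ p ∈ (Finset.Ioc a b).filter Nat.Prime, θ p * ((p : ℂ) ^ (-(t * I)) * p) =
      ∑ n ∈ Finset.Ioc a b, c n * (g n : ℂ) := by
    rw [Finset.sum_filter]
    refine Finset.sum_congr rfl fun n _ ↦ ?_
    simp only [hcdef, hgdef]
    split_ifs with hp
    · have hn2 : (2 : ℝ) ≤ n := by exact_mod_cast hp.two_le
      have hlog : Real.log n ≠ 0 := (Real.log_pos (by linarith : (1 : ℝ) < n)).ne'
      have e : ((((n : ℝ) / Real.log n : ℝ)) : ℂ) * (Real.log n : ℂ) = (n : ℂ) := by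
        rw [← Complex.ofReal_natCast, ← Complex.ofReal_mul, div_mul_cancel₀ _ hlog]
      calc θ n * ((n : ℂ) ^ (-(t * I)) * n)
          = θ n * (n : ℂ) ^ (-(t * I)) * ((((n : ℝ) / Real.log n : ℝ) : ℂ) * (Real.log n : ℂ)) := by
            rw [e]; ring
        _ = θ n * (n : ℂ) ^ (-(t * I)) * (Real.log n : ℂ) * (((n : ℝ) / Real.log n : ℝ) : ℂ) := by
            ring
    · simp
  have hg0 : ∀ n, a < n → 0 ≤ g n := fun n hn ↦ by
    simp only [hgdef]
    exact div_nonneg (Nat.cast_nonneg _) (Real.log_nonneg (by exact_mod_cast (show 1 ≤ n by omega)))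
  have haP : ∀ n : ℕ, a < n → P < n := fun n hn ↦ by
    have h1 := Nat.lt_floor_add_one P
    have h2 : ((⌊P⌋₊ + 1 : ℕ) : ℝ) ≤ n := by exact_mod_cast hn
    push_cast at h2; rw [hadef] at hn; linarith
  have hmono : ∀ n, a < n → g n ≤ g (n + 1) := fun n hn ↦ by
    have h3 : 3 ≤ n := by
      have : (3 : ℝ) ≤ n := hP3.trans (haP n hn).le
      exact_mod_cast this
    simp only [hgdef]; push_cast
    exact div_log_le_succ h3
  have hAb : ∀ u', a ≤ u' → u' ≤ b → ‖∑ n ∈ Finset.Ioc a u', c n‖ ≤ MA := by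
    intro u' hau hub
    rcases hau.eq_or_lt with h | h
    · rw [← h, Finset.Ioc_self, Finset.sum_empty, norm_zero]; exact hMA0
    · rw [hcdef, ← Finset.sum_filter]
      refine hWin u' h ?_
      calc ((u' : ℕ) : ℝ) ≤ b := by exact_mod_cast hub
        _ ≤ u := Nat.floor_le hu0
        _ ≤ P * (1 + (L ^ 68)⁻¹) := huP
  have habel := norm_sum_Ioc_mul_le_of_monotone hg0 hmono hAb hab
  have hgb : g b ≤ 2 * P / L ^ 9 := by
    have hbP : P < b := haP b hab
    have hb0 : (0 : ℝ) < b := hP0.trans hbP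
    have hlogb : L ^ 9 ≤ Real.log b := by
      rw [← Real.log_exp (L ^ 9)]; exact Real.log_le_log hP0 hbP.le
    have hb2 : (b : ℝ) ≤ 2 * P := (Nat.floor_le hu0).trans (huP.trans hP2)
    simp only [hgdef]
    calc (b : ℝ) / Real.log b ≤ (b : ℝ) / L ^ 9 := div_le_div_of_nonneg_left hb0.le (by positivity) hlogb
      _ ≤ 2 * P / L ^ 9 := div_le_div_of_nonneg_right hb2 (by positivity)
  rw [hident]
  calc ‖∑ n ∈ Finset.Ioc a b, c n * (g n : ℂ)‖ ≤ 2 * MA * g b := habel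
    _ ≤ 2 * MA * (2 * P / L ^ 9) := mul_le_mul_of_nonneg_left hgb (by positivity)
    _ = 4 * MA * P / L ^ 9 := by ring
    _ ≤ (12 * C₀ + 3) * P ^ 2 * (L ^ 77)⁻¹ * Real.exp (-M) := hfinal_unit

/-- **Zhang 2022, Lemma 5.6, as printed (twist `p^{1+it}`).** There are `D₀ : ℕ` and `C > 0` such
that for every `D ≥ D₀`, every `χ ≠ χ₀` mod `D` with (A) `‖L(1, χ)‖ < (log D)⁻²⁰²²`, every
`1 < r < exp((log D)^{11/10})` (`= T` of the source), every primitive `θ` mod `r` with `θ ≠ χ` (as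
characters mod `Dr`), every real `t` with `|t| ≤ D`, and every `u` with
`P ≤ u ≤ P(1 + (log D)⁻⁶⁸)`, `P = exp((log D)⁹)`:
`‖∑_{P < p ≤ u} θ(p) p^{1+it}‖ ≤ C P² (log D)⁻⁷⁷ exp(−(log D)^{9/2})`
(the printed `≪ 𝔓 exp(−𝓛^{9/2})`, `𝔓 = (1 + o(1))P²𝓛⁻⁷⁷` by (2.9); the printed range of summation
`P < p < P(1 + 𝓛⁻⁶⁸)` is the case `u ↑ P(1 + 𝓛⁻⁶⁸)`).
[cite: Zhang2022LandauSiegel, Lemma 5.6, p. 11; (2.6), (2.9) p. 4; T = exp 𝓛^{1.1}, p. 12]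
[cite: MontgomeryVaughan2007, Theorems 10.17, 11.3, 11.7, 12.10] [cite: Linnik1944]
[cite: Bombieri1987GrandCrible, §6 Théorème 14] -/
theorem lemma56 :
    ∃ D₀ : ℕ, ∃ C : ℝ, 0 < C ∧ ∀ (D : ℕ) [NeZero D], D₀ ≤ D → ∀ χ : DirichletCharacter ℂ D, χ ≠ 1 →
      ‖χ.LFunction 1‖ < (Real.log D ^ 2022)⁻¹ →
      ∀ (r : ℕ) [NeZero r], 1 < r → (r : ℝ) < Real.exp (Real.log D ^ ((11 : ℝ) / 10)) →
      ∀ θ : DirichletCharacter ℂ r, θ.IsPrimitive →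
        changeLevel (Nat.dvd_mul_left r D) θ ≠ changeLevel (Nat.dvd_mul_right D r) χ →
      ∀ t : ℝ, |t| ≤ D → ∀ u : ℝ, Real.exp (Real.log D ^ 9) ≤ u →
        u ≤ Real.exp (Real.log D ^ 9) * (1 + (Real.log D ^ 68)⁻¹) →
        ‖∑ p ∈ (Finset.Ioc ⌊Real.exp (Real.log D ^ 9)⌋₊ ⌊u⌋₊).filter Nat.Prime,
            θ p * (p : ℂ) ^ (1 + t * I)‖ ≤
          C * Real.exp (Real.log D ^ 9) ^ 2 * (Real.log D ^ 77)⁻¹ *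
            Real.exp (-(Real.log D ^ ((9 : ℝ) / 2))) := by
  obtain ⟨D₀, C, hC, H⟩ := lemma56_twist
  refine ⟨D₀, C, hC, fun D _ hD χ hχ hA r _ hr1 hrT θ hprim hne t ht u hPu huP ↦ ?_⟩
  have h := H D hD χ hχ hA r hr1 hrT θ hprim hne (-t) (by rwa [abs_neg]) u hPu huP
  have hsum : ∑ p ∈ (Finset.Ioc ⌊Real.exp (Real.log D ^ 9)⌋₊ ⌊u⌋₊).filter Nat.Prime,
      θ p * (p : ℂ) ^ (1 + t * I) =
      ∑ p ∈ (Finset.Ioc ⌊Real.exp (Real.log D ^ 9)⌋₊ ⌊u⌋₊).filter Nat.Prime,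
        θ p * ((p : ℂ) ^ (-(((-t : ℝ) : ℂ) * I)) * p) := by
    refine Finset.sum_congr rfl fun p hp ↦ ?_
    have hp0 : (p : ℂ) ≠ 0 := by exact_mod_cast (Finset.mem_filter.1 hp).2.ne_zero
    rw [cpow_add _ _ hp0, cpow_one]
    push_cast
    ring_nf
  rw [hsum]
  exact h

end Literature.NumberTheory.LFunctions.Zhang2022

end
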